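import Summits.QuantumFields.YangMills.Theorems.BalabanUVNodesN15DefectKernelVectorPieceAdjDeriv
import Summits.QuantumFields.YangMills.Theorems.BalabanUVNodesN15DefectKernelVectorPieceTorus
import HarnessLib

/-!
# Route «BalabanUVNodes» (K4 «SpineRates»), node N15 = NE2, THE -a ∕ -b INTERFACE OF THE BACKGROUND LAYER: THE MIXED SECOND-ORDER PIECE OF THE
# VECTOR SINGLE-SCALE PIECE — `𝔇((∂′_μH′)C′(w′(∂′_νH′)ᵀ), (∂_μH)C(w(∂_νH)ᵀ))` in binder (a)'s format, the (3.44)-shaped entry `∇_UG′∇*_U`, on any carrier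
# and on the concrete unit-torus carrier

Cell `pub-ymgap`, seat `pub-ymgap-dag-n15-c` (generation g0; R134 ACCELERATION SEAT, strategy s1 = FIRST-MISSING-ESTIMATE of the background layer's
OPERATOR inputs; HUMAN RULING D-0062; chair R424 venue; `bears_on: R4∕N15`).  Filed `--supports stmt-QuantumFields-19676` (K3 `SpineGivenEndpointR11`;
helper).  THEOREMS ONLY; imports BY NAME, nothing in the tree modified: n15-a parts 12∕13 `…VectorPieceDeriv`∕`…VectorPieceAdjDeriv` (pattern and §1
`norm_dker_le_tdistT`), part 11 `…DefectKernelDHk163` (`hasMaj_idef_dhk163`, `norm_dker_kingPair_sub_le`, `rateD_nonneg`), part 9 (`card_fibre_bondPair`),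
parts 1∕3∕4 (n15-a g2: `hasMaj_ofBlocks_of_entry_le`, `hasMaj_idef_id_id_of_rate`, `hasMaj_idef_transpose_of_pairedRate`, `king_weight_balance`), part 10
`…VectorPieceTorus` (the concrete-carrier pattern), the defect calculus `T4EtaRateDefect.idef_comp_majorant` (pv25), `B9SectDWeightedNeumann` (`WRow`,
`wrow_of_exp`, `hasMaj_comp_wrow`), the b05 lineage (`HkOp`, `B5Hk163TorusHolderDecay`), the t4-ne2∕b06 lineage `T4Cov2156Rate` (`cov2156_pair_torus`,
`cov2156_rate_torus_king`), the carrier module `B6UnitTorusCarrier`.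

WHY (the located gap of the background layer, n15-b parts B3∕B4 headers: «the mixed `∂H∂*` piece is NOT in the tree — located, not claimed»).  n15-b's
first-order background-dependent pair (`…N15.BackgroundLayer.ne2PlusOperator_background₁4`, B4) displays, as its ONLY hypotheses, the `U ≡ 1` operator
layer: uniform majorants and two-lattice η-defects of the FIVE pairs `(G′,G)`, `(∇′_μG′,∇_μG)`, `(G′∇′*,G∇*)`, `(∇′_μG′∇′*,∇_μG∇*)`, `(Δ′G′,ΔG)`.  Four of them are
n15-a's parts 9–23 on the unit torus; the MIXED pair `(∇′_μG′∇′_ν*, ∇_μG∇_ν*)` — [B9] (3.44)'s `|∇_UG′∇*_Uλ|`, the source stack's `some μ` components in B3 —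
had no tree theorem.  For the single-scale piece `G = H·C·(w·Hᵀ)` it is `∇_μG∇_ν* = (∂_μH)·C·(w·(∂_νH)ᵀ)`: part 12's LEFT leg (the typed derivative
`∂_μH_k = fdiff·HkOp`, decay b05 `norm_dker_bpt_le`, two-lattice rate part 11) together with part 13's RIGHT leg (the Riemann-weighted transpose of `∂_νH_k`,
part 4's transpose mechanism fed by part 11's paired rate), the (2.156) middle factor as in part 9 — King's (4.42)–(4.43) mechanism (`idef_comp_majorant`
twice).  Every analytic input is a tree theorem BY NAME; this file is the assembly (§1) and its instantiation on the honest concrete carrier (§2).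

CONTENTS.  §1 **`hasMaj_idef_vectorPieceMixed`**: `∃ B₀ C₁ δ′ > 0` such that for every unit torus (`L ∣ M_ν`, `d + 1 ≥ 2`, `L ≥ 1`), levels `k`, `m ≥ 1`,
directions `μ, ν`, exponents `0 ≤ α < 1`, `0 < γ < 1`: `𝔇(D′_μC′K′_ν, D_μCK_ν)` through (pull, pull) has the block majorant
`[nΩc_Dc_r·(m₀ε_D + nΩR_Cc_r·a_D) + nΩR_Dc_r·m₀·a_D]·e^{−ρd}` with `c_D = MD163·periodConst`, `R_D = √(ρ_D(L^k)·2MD163·periodConst)` (part 11),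
`ε_D = n_ηwR_D`, `a_D = n_ηwc_D`, `R_C = C₁L^{−k}`, `m₀ = nΩB₀c_r`; binders as in parts 12∕13 (H-dominance at the HALVED rate `δ·d ≤ (δ_H∕2)·|b − B(i)|_T`,
window `ρ + σ_r ≤ δ`, `ρ + σ_r ≤ δ_C`).  §2 **`hasMaj_idef_vectorPieceMixed_unitTorus`**: §1 on `B6UnitTorusCarrier.unitTorusGeo L k M` with every GEOMETRIC
binder discharged (unit bonds ↦ base point, fine bonds ↦ King's block, dominances with equality, (2.61) at `σ_r = min(δ_H∕2, δ′)∕2`), part 14's pattern.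

HONEST FRAMING ∕ LIMITS.  `U = 1` LINEAR theory on FINITE tori (b05∕b06 torus model), `d + 1 ≥ 2`; ONE single-scale piece in King's (4.42) SHAPE with
Bałaban's vector factors; rate of both legs `L^{−k·min(α,γ)∕2}` (part 11); no new analytic estimate beyond parts 8–14's inputs (assembly + instantiation);
NOT [B6]'s multiscale expansion (NODE 00), NOT the telescoping over `j`; nothing with background (NE2⁺ proper NOT PRINTED ∕ not proved); count-neutral
(typed 28∕28 · discharged unchanged); NOT a discharge of N15; one finite T⁴ at fixed ε — NOT infinite volume, NOT OS on ℝ⁴, NOT a mass gap, NOT Clay.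
-/

noncomputable section

open scoped BigOperators
open Finset

namespace Summit.QuantumFields.YangMills.BalabanUVNodes.N15.DefectKernel

open Literature.MathematicalPhysics.QuantumFieldTheory.Balaban1983to89
open Literature.MathematicalPhysics.QuantumFieldTheory.Balaban1983to89.B11SectG (BlockNorm HasMaj RowSum)
open Literature.MathematicalPhysics.QuantumFieldTheory.Balaban1983to89.T4EtaRateDefect (idef idef_comp_majorant slowWeight_const)
open Literature.MathematicalPhysics.QuantumFieldTheory.Balaban1983to89.T4EtaRateCoeffDefect (pull fibre mem_fibre)
open Literature.MathematicalPhysics.QuantumFieldTheory.Balaban1983to89.B9SectDWeightedNeumann (WRow wrow_of_exp hasMaj_comp_wrow)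
open Literature.MathematicalPhysics.QuantumFieldTheory.Balaban1983to89.B6RandomWalk (Triangle254)
open Literature.MathematicalPhysics.QuantumFieldTheory.Balaban1983to89.B4TorusKernel (periodConst)
open Literature.MathematicalPhysics.QuantumFieldTheory.Balaban1983to89.B5Prop11Plancherel (Tor fine)
open Literature.MathematicalPhysics.QuantumFieldTheory.Balaban1983to89.B5Block118 (bpt)
open Literature.MathematicalPhysics.QuantumFieldTheory.Balaban1983to89.B5Blocks16 (bpt_val bpt_bijective)
open Literature.MathematicalPhysics.QuantumFieldTheory.Balaban1983to89.B5Hk163Strip (kappa163 kappa163_pos)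
open Literature.MathematicalPhysics.QuantumFieldTheory.Balaban1983to89.B5Hk163Decay (MG163)
open Literature.MathematicalPhysics.QuantumFieldTheory.Balaban1983to89.B5Hk163Torus (HkOp norm_HkOp_le)
open Literature.MathematicalPhysics.QuantumFieldTheory.Balaban1983to89.B5Hk163TorusHolder (dker fdiff_HkOp_apply)
open Literature.MathematicalPhysics.QuantumFieldTheory.Balaban1983to89.B5Hk163TorusHolderDecay (MD163 norm_dker_bpt_le)
open Literature.MathematicalPhysics.QuantumFieldTheory.Balaban1983to89.B5Hk163RateSum (C0maj C1maj T163)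
open Literature.MathematicalPhysics.QuantumFieldTheory.Balaban1983to89.T4Hk163StripRate (CGe)
open Literature.MathematicalPhysics.QuantumFieldTheory.Balaban1983to89.B6LowerBound2153Torus (toT rep toT_rep rep_mem_pbox)
open Literature.MathematicalPhysics.QuantumFieldTheory.Balaban1983to89.B6Lemma24Torus (pbox)
open Literature.MathematicalPhysics.QuantumFieldTheory.Balaban1983to89.B6BondEliminationTorus (pdist)
open Literature.MathematicalPhysics.QuantumFieldTheory.Balaban1983to89.B6Cov2156Torus (deltaPol bondReductionT one_le_M)
open Literature.MathematicalPhysics.QuantumFieldTheory.Balaban1983to89.T4Cov2156Rate (cov2156_pair_torus cov2156_rate_torus_king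
  bondDist_nonneg)
open Literature.MathematicalPhysics.QuantumFieldTheory.Balaban1983to89.B6UnitTorusCarrier (unitTorusGeo triangle254_unitTorusGeo
  unitTorusGeo_dist_nonneg unitTorusGeo_dist_symm rowSum_unitTorusGeo card_fibre_unitBond card_fibre_fineBond pdist_rep_rep)
open Literature.MathematicalPhysics.QuantumFieldTheory.King1986 (exp_decay_mono aliasConst)
open Literature.MathematicalPhysics.QuantumFieldTheory.King1986.Torus (blockOf val_blockOf tdistT tdistT_symm tdistT_nonneg blockOf_over)

variable {d : ℕ}

/-! ## §1 The assembly: the mixed second-order piece of the vector single-scale piece in binder (a)'s format -/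

section Piece

/-- **THE MIXED SECOND-ORDER PIECE OF THE VECTOR SINGLE-SCALE PIECE `𝔇(D′_μC′K′_ν, D_μCK_ν)` IN BINDER (a)'s FORMAT, EVERY ANALYTIC INPUT A TREE
THEOREM** (`D_μ = ∂_μH_k`, `K_ν = w·(∂_νH_k)ᵀ`; the (3.44)-shaped entry `∇_UG′∇*_U` of the piece `P = HCK`).  Part 9's assembly with the LEFT factor the typed
derivative `fdiff·HkOp` in direction `μ` (entry binders `hDμ`, `hDμ′`; defect part 11, decay b05) and the RIGHT pair the Riemann-weighted transpose of the
typed derivative in direction `ν` (entry binders `hDν`, `hDν′`, `hK`, `hK′`; paired rate part 11, decay b05), both at the H-dominance's halved rate `δ_H∕2`;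
the (2.156) middle factor as in part 9. [cite: King1986, (4.42)–(4.43) p.675 (mechanism), Prop. 3.8 (3.71) p.664 (second line, shape); Balaban1984PropagatorsI, (1.63) p.28; Balaban1984PropagatorsII, (2.156) p.250; Balaban1985BackgroundPropagators, (3.44) p.397 (the mixed entry: the format's use)] -/
theorem hasMaj_idef_vectorPieceMixed (hd : 1 ≤ d) {L : ℕ} [NeZero L] (hL : 1 ≤ L) {α γ : ℝ} (hα0 : 0 ≤ α) (hα1 : α < 1)
    (hγ0 : 0 < γ) (hγ1 : γ < 1) (μ ν : Fin (d + 1)) :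
    ∃ B₀ C₁ δ' : ℝ, 0 < B₀ ∧ 0 < C₁ ∧ 0 < δ' ∧ ∀ (M : Fin (d + 1) → ℕ) [∀ μ, NeZero (M μ)] (_ : ∀ i, L ∣ M i)
      (k m : ℕ) (_ : 1 ≤ m)
      -- the carrier and the site assignments
      {g : B6.Geometry} [DecidableEq g.Site] (_ : Triangle254 g) (_ : ∀ y y' : g.Site, 0 ≤ g.dist y y')
      (_ : ∀ y y' : g.Site, g.dist y y' = g.dist y' y) {σr cr : ℝ} (_ : 0 ≤ σr) (_ : RowSum g σr cr)
      (blkΩ : Tor M × Fin (d + 1) → g.Site) {nΩ : ℕ} (_ : ∀ y', (fibre blkΩ y').card ≤ nΩ)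
      (blkη : Tor (fine (L ^ k) M) × Fin (d + 1) → g.Site) {nη : ℕ} (_ : ∀ y', (fibre blkη y').card ≤ nη)
      (pr : Tor (fine (L ^ m * L ^ k) M) → Tor (fine (L ^ k) M)) (_ : ∀ x' μ, (pr x' μ).val = (x' μ).val / L ^ m)
      (prV : Tor (fine (L ^ m * L ^ k) M) × Fin (d + 1) → Tor (fine (L ^ k) M) × Fin (d + 1))
      (_ : ∀ i, prV i = (pr i.1, i.2))
      -- Bałaban's operators, read off by their entries: the two derivative kernels at both spacings
      (Dμ : (Tor M × Fin (d + 1) → ℝ) →ₗ[ℝ] (Tor (fine (L ^ k) M) × Fin (d + 1) → ℝ))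
      (_ : ∀ b i, Dμ (Pi.single b 1) i = ((B5Prop11Plancherel.fdiff (fine (L ^ k) M) ((L ^ k : ℕ) : ℂ) μ * HkOp (L ^ k) M) i b).re)
      (Dμ' : (Tor M × Fin (d + 1) → ℝ) →ₗ[ℝ] (Tor (fine (L ^ m * L ^ k) M) × Fin (d + 1) → ℝ))
      (_ : ∀ b i, Dμ' (Pi.single b 1) i =
        ((B5Prop11Plancherel.fdiff (fine (L ^ m * L ^ k) M) ((L ^ m * L ^ k : ℕ) : ℂ) μ * HkOp (L ^ m * L ^ k) M) i b).re)
      (Dν : (Tor M × Fin (d + 1) → ℝ) →ₗ[ℝ] (Tor (fine (L ^ k) M) × Fin (d + 1) → ℝ))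
      (_ : ∀ b i, Dν (Pi.single b 1) i = ((B5Prop11Plancherel.fdiff (fine (L ^ k) M) ((L ^ k : ℕ) : ℂ) ν * HkOp (L ^ k) M) i b).re)
      (Dν' : (Tor M × Fin (d + 1) → ℝ) →ₗ[ℝ] (Tor (fine (L ^ m * L ^ k) M) × Fin (d + 1) → ℝ))
      (_ : ∀ b i, Dν' (Pi.single b 1) i =
        ((B5Prop11Plancherel.fdiff (fine (L ^ m * L ^ k) M) ((L ^ m * L ^ k : ℕ) : ℂ) ν * HkOp (L ^ m * L ^ k) M) i b).re)
      {w : ℝ} (_ : 0 ≤ w) (K : (Tor (fine (L ^ k) M) × Fin (d + 1) → ℝ) →ₗ[ℝ] (Tor M × Fin (d + 1) → ℝ))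
      (_ : ∀ i b, K (Pi.single i 1) b = w * Dν (Pi.single b 1) i)
      (K' : (Tor (fine (L ^ m * L ^ k) M) × Fin (d + 1) → ℝ) →ₗ[ℝ] (Tor M × Fin (d + 1) → ℝ))
      (_ : ∀ i' b, K' (Pi.single i' 1) b = w / ((L : ℝ) ^ m) ^ (d + 1) * Dν' (Pi.single b 1) i')
      (e : Tor M × Fin (d + 1) → B4.Idx (pbox M) (d + 1))
      (C : (Tor M × Fin (d + 1) → ℝ) →ₗ[ℝ] (Tor M × Fin (d + 1) → ℝ))
      (_ : ∀ b b', C (Pi.single b' 1) b = (bondReductionT L M (deltaPol M (L ^ k))).cov (e b) (e b'))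
      (C' : (Tor M × Fin (d + 1) → ℝ) →ₗ[ℝ] (Tor M × Fin (d + 1) → ℝ))
      (_ : ∀ b b', C' (Pi.single b' 1) b = (bondReductionT L M (deltaPol M (L ^ (k + m)))).cov (e b) (e b'))
      -- the two unit-torus dominances (the consumer's reading of its site assignments)
      {δ : ℝ} (_ : ∀ (b : Tor M × Fin (d + 1)) (i : Tor (fine (L ^ k) M) × Fin (d + 1)),
        δ * g.dist (blkΩ b) (blkη i) ≤ kappa163 (d + 1) / (d + 1) / 2 * tdistT M b.1 (blockOf (L ^ k) M i.1))
      {δC : ℝ} (_ : ∀ b b' : Tor M × Fin (d + 1),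
        δC * g.dist (blkΩ b) (blkΩ b') ≤ δ' * pdist M (one_le_M M) ((e b).1 : Fin (d + 1) → ℤ) ((e b').1 : Fin (d + 1) → ℤ))
      -- the rate window
      {ρ : ℝ} (_ : 0 ≤ ρ) (_ : ρ + σr ≤ δ) (_ : ρ + σr ≤ δC),
      HasMaj (BlockNorm.ofBlocks g blkη) (BlockNorm.ofBlocks g (blkη ∘ prV))
        (idef (pull prV) (pull prV) (Dμ' ∘ₗ (C' ∘ₗ K')) (Dμ ∘ₗ (C ∘ₗ K)))
        (fun y y' =>
          (nΩ * (MD163 (d + 1) * periodConst (kappa163 (d + 1)) d) * cr *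
              (nΩ * B₀ * cr *
                  (nη * w * ((2 ^ (1 - α) * (((d + 1 : ℕ) : ℝ) / ((L ^ k : ℕ) : ℝ)) ^ α *
                  (C0maj (d + 1) * (Real.pi * Real.pi ^ α) + C1maj (d + 1) * aliasConst (d + 1) α)
                + T163 (d + 1) 0 γ / ((L ^ k : ℕ) : ℝ) ^ γ) ^ (1 / 2 : ℝ)
              * (2 * (MD163 (d + 1) * periodConst (kappa163 (d + 1)) d)) ^ (1 / 2 : ℝ)))
                + nΩ * (C₁ * ((L : ℝ) ^ k)⁻¹) * cr * (nη * w * (MD163 (d + 1) * periodConst (kappa163 (d + 1)) d)))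
            + nΩ * ((2 ^ (1 - α) * (((d + 1 : ℕ) : ℝ) / ((L ^ k : ℕ) : ℝ)) ^ α *
                  (C0maj (d + 1) * (Real.pi * Real.pi ^ α) + C1maj (d + 1) * aliasConst (d + 1) α)
                + T163 (d + 1) 0 γ / ((L ^ k : ℕ) : ℝ) ^ γ) ^ (1 / 2 : ℝ)
              * (2 * (MD163 (d + 1) * periodConst (kappa163 (d + 1)) d)) ^ (1 / 2 : ℝ)) * cr *
              (nΩ * B₀ * cr * (nη * w * (MD163 (d + 1) * periodConst (kappa163 (d + 1)) d)))) *
          Real.exp (-(ρ * g.dist y y'))) := by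
  have hd1 : 2 ≤ d + 1 := by omega
  obtain ⟨B₀, δ₀, hB₀, hδ₀, HP⟩ := cov2156_pair_torus (d := d + 1) hd1 hL
  obtain ⟨C₁, δ₁, hC₁, hδ₁, HR⟩ := cov2156_rate_torus_king (d := d + 1) hd1 hL
  refine ⟨B₀, C₁, min δ₀ δ₁, hB₀, hC₁, lt_min hδ₀ hδ₁, ?_⟩
  intro M _ hLM k m hm g _ htri hdist hsymm σr cr hσr hrow blkΩ nΩ hnΩ blkη nη hnη pr hpr prV hprV Dμ hDμ Dμ' hDμ' Dν hDν Dν' hDν'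
    w hw0 K hK K' hK' e C hC C' hC' δ hdomH2 δC hdomC ρ hρ hρ₁ hρ₂
  -- the H-dominance at the full rate follows from the halved one
  have hdomH : ∀ (b : Tor M × Fin (d + 1)) (i : Tor (fine (L ^ k) M) × Fin (d + 1)),
      δ * g.dist (blkΩ b) (blkη i) ≤ kappa163 (d + 1) / (d + 1) * tdistT M b.1 (blockOf (L ^ k) M i.1) := fun b i =>
    (hdomH2 b i).trans (by
      have := tdistT_nonneg M b.1 (blockOf (L ^ k) M i.1)
      have hκ : 0 ≤ kappa163 (d + 1) / (d + 1) := (div_pos (kappa163_pos _) (by positivity)).le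
      nlinarith)
  -- names for the constants
  set RC : ℝ := C₁ * ((L : ℝ) ^ k)⁻¹ with hRCdef
  set cD : ℝ := MD163 (d + 1) * periodConst (kappa163 (d + 1)) d with hcDdef
  set RD : ℝ := ((2 ^ (1 - α) * (((d + 1 : ℕ) : ℝ) / ((L ^ k : ℕ) : ℝ)) ^ α *     (C0maj (d + 1) * (Real.pi * Real.pi ^ α) + C1maj (d + 1) * aliasConst (d + 1) α)   + T163 (d + 1) 0 γ / ((L ^ k : ℕ) : ℝ) ^ γ) ^ (1 / 2 : ℝ) * (2 * (MD163 (d + 1) * periodConst (kappa163 (d + 1)) d)) ^ (1 / 2 : ℝ)) with hRDdef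
  have hcD : 0 ≤ cD := B5Hk163TorusHolderDecay.CdecD_nonneg (d := d)
  have hRD0 : 0 ≤ RD := mul_nonneg (Real.rpow_nonneg (rateD_nonneg (L ^ k) hα0 hα1 hγ0 hγ1 ν ν ν) _)
    (Real.rpow_nonneg (mul_nonneg zero_le_two (B5Hk163TorusHolderDecay.CdecD_nonneg (d := d))) _)
  have hRC0 : 0 ≤ RC := mul_nonneg hC₁.le (inv_nonneg.mpr (pow_nonneg (Nat.cast_nonneg _) _))
  have hnηw : 0 ≤ (nη : ℝ) * w := mul_nonneg (Nat.cast_nonneg _) hw0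
  -- the right D-leg (coarse, direction `ν`): uniform decay of the derivative kernel (b05 `norm_dker_bpt_le`), in the carrier
  have hdecD : ∀ (b : Tor M × Fin (d + 1)) (i : Tor (fine (L ^ k) M) × Fin (d + 1)),
      |Dν (Pi.single b 1) i| ≤ cD * Real.exp (-(δ * g.dist (blkΩ b) (blkη i))) := fun b i => by
    rw [hDν]
    refine (Complex.abs_re_le_norm _).trans ((norm_dker_le_tdistT (L ^ k) M ν i.2 b.2 i.1 b.1).trans ?_)
    refine mul_le_mul_of_nonneg_left (Real.exp_le_exp.mpr ?_) hcD
    have := hdomH b i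
    rw [tdistT_symm] at this
    linarith
  -- the left D-leg (fine, direction `μ`): uniform decay of the fine derivative kernel, in the carrier
  have hdecD' : ∀ (b : Tor M × Fin (d + 1)) (i' : Tor (fine (L ^ m * L ^ k) M) × Fin (d + 1)),
      |Dμ' (Pi.single b 1) i'| ≤ cD * Real.exp (-(δ * g.dist (blkΩ b) (blkη (prV i')))) := fun b i' => by
    rw [hDμ']
    refine (Complex.abs_re_le_norm _).trans ((norm_dker_le_tdistT (L ^ m * L ^ k) M μ i'.2 b.2 i'.1 b.1).trans ?_)
    refine mul_le_mul_of_nonneg_left (Real.exp_le_exp.mpr ?_) hcD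
    have h1 := hdomH b (prV i')
    simp only [hprV] at h1
    rw [tdistT_symm, ← blockOf_over M (pr i'.1) i'.1 (hpr i'.1)] at h1
    simp only [hprV]
    linarith
  -- (i) the undifferenced COARSE adjoint factor `K = w·D_νᵀ`: `a_D·e^{−ρd}`, `a_D = n_η w c_D`
  have hδρ : ρ ≤ δ := by linarith
  have hKmaj : HasMaj (BlockNorm.ofBlocks g blkη) (BlockNorm.ofBlocks g blkΩ) K
      (fun y y' => nη * w * cD * Real.exp (-((ρ + 0) * g.dist y y'))) := by
    have key := hasMaj_ofBlocks_of_entry_le blkη blkΩ (T := K)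
      (κ := fun y y' => w * cD * Real.exp (-(ρ * g.dist y y')))
      (fun _ _ => mul_nonneg (mul_nonneg hw0 hcD) (Real.exp_nonneg _)) hnη fun b i => by
        rw [hK, abs_mul, abs_of_nonneg hw0, mul_assoc]
        refine mul_le_mul_of_nonneg_left ((hdecD b i).trans ?_) hw0
        rw [hsymm]
        exact exp_decay_mono hcD hδρ (hdist _ _)
    refine key.mono fun y y' => le_of_eq ?_
    rw [add_zero]; ring
  have hKmaj' : HasMaj (BlockNorm.ofBlocks g blkη) (BlockNorm.ofBlocks g blkΩ) K
      (fun y y' => nη * w * cD * Real.exp (-(ρ * g.dist y y'))) := by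
    simpa only [add_zero] using hKmaj
  -- (ii) the DEFECT of the adjoint factor (part 4's transpose mechanism + part 11's paired rate of `∂_νH_k`): `ε_D·e^{−ρd}·1`, `ε_D = n_η w R_D`
  have hw' : 0 ≤ w / ((L : ℝ) ^ m) ^ (d + 1) := div_nonneg hw0 (pow_nonneg (pow_nonneg (Nat.cast_nonneg _) _) _)
  have hbal : ∀ i : Tor (fine (L ^ k) M) × Fin (d + 1), w / ((L : ℝ) ^ m) ^ (d + 1) * ((fibre prV i).card : ℝ) = w := by
    rintro ⟨x, lam⟩
    rw [card_fibre_bondPair pr prV hprV x lam]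
    exact king_weight_balance L k m M pr hpr w x
  have hDK : HasMaj (BlockNorm.ofBlocks g blkη) (BlockNorm.ofBlocks g blkΩ) (idef (pull prV) LinearMap.id K' K)
      (fun y y' => nη * w * RD * Real.exp (-(ρ * g.dist y y')) * (fun _ : g.Site => (1 : ℝ)) y') := by
    have key := hasMaj_idef_transpose_of_pairedRate blkη blkΩ hnη prV hw0 hw' hK hK' hbal
      (κ := fun y y' => RD * Real.exp (-(ρ * g.dist y y'))) (fun _ _ => mul_nonneg hRD0 (Real.exp_nonneg _))
      fun b i' => by
        have h1 := hdomH2 b (prV i')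
        simp only [hprV] at h1 ⊢
        rw [tdistT_symm, ← blockOf_over M (pr i'.1) i'.1 (hpr i'.1)] at h1
        rw [hDν', hDν, ← Complex.sub_re]
        refine (Complex.abs_re_le_norm _).trans
          ((norm_dker_kingPair_sub_le (L ^ m) (L ^ k) M hα0 hα1 hγ0 hγ1 pr hpr i'.2 b.2 ν i'.1 b.1).trans ?_)
        refine mul_le_mul_of_nonneg_left (Real.exp_le_exp.mpr ?_) hRD0
        have h2 : ρ * g.dist (blkΩ b) (blkη (pr i'.1, i'.2)) ≤ δ * g.dist (blkΩ b) (blkη (pr i'.1, i'.2)) :=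
          mul_le_mul_of_nonneg_right hδρ (hdist _ _)
        linarith
    refine key.mono fun y y' => le_of_eq ?_
    ring
  -- (iii) the DEFECT of the covariance ((2.156) rate, identity pairing): `N_C·1`, `N_C = nΩ R_C e^{−δ_C d}`, `‖N_C‖_ρ ≤ nΩ R_C c_r`
  have hDC : HasMaj (BlockNorm.ofBlocks g blkΩ) (BlockNorm.ofBlocks g blkΩ) (idef LinearMap.id LinearMap.id C' C)
      (fun y y' => nΩ * RC * Real.exp (-(δC * g.dist y y')) * (fun _ : g.Site => (1 : ℝ)) y') := by
    have key := hasMaj_idef_id_id_of_rate blkΩ hnΩ C' C (t := fun b b' =>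
        pdist M (one_le_M M) ((e b).1 : Fin (d + 1) → ℤ) ((e b').1 : Fin (d + 1) → ℤ)) hRC0 hdomC fun b b' => by
      rw [hC', hC]
      exact (HR M hLM k m (e b) (e b')).trans
        (exp_decay_mono hRC0 (min_le_right _ _) (bondDist_nonneg (one_le_M M) _ _))
    exact key.mono fun y y' => le_of_eq (by rw [mul_one])
  have hNC_wrow : WRow g ρ (fun y y' => nΩ * RC * Real.exp (-(δC * g.dist y y'))) (nΩ * RC * cr) :=
    wrow_of_exp hdist hrow (mul_nonneg (Nat.cast_nonneg _) hRC0) hρ₂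
  -- (iv) the undifferenced covariances `C`, `C′`: `N₀ = nΩ B₀ e^{−δ_C d}`, `‖N₀‖_ρ ≤ nΩ B₀ c_r`
  have hCov : ∀ {kk : ℕ} {T : (Tor M × Fin (d + 1) → ℝ) →ₗ[ℝ] (Tor M × Fin (d + 1) → ℝ)},
      (∀ b b', T (Pi.single b' 1) b = (bondReductionT L M (deltaPol M (L ^ kk))).cov (e b) (e b')) →
      HasMaj (BlockNorm.ofBlocks g blkΩ) (BlockNorm.ofBlocks g blkΩ) T
        (fun y y' => nΩ * (B₀ * Real.exp (-(δC * g.dist y y')))) := by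
    intro kk T hT
    refine hasMaj_ofBlocks_of_entry_le blkΩ blkΩ (κ := fun y y' => B₀ * Real.exp (-(δC * g.dist y y')))
      (fun _ _ => mul_nonneg hB₀.le (Real.exp_nonneg _)) hnΩ fun b b' => ?_
    rw [hT]
    refine ((HP M hLM kk (e b) (e b')).1).trans ?_
    refine (exp_decay_mono hB₀.le (min_le_left δ₀ δ₁) (bondDist_nonneg (one_le_M M) _ _)).trans ?_
    exact mul_le_mul_of_nonneg_left (Real.exp_le_exp.mpr (by linarith [hdomC b b'])) hB₀.le
  have hCmaj := hCov (kk := k) (T := C) hC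
  have hC'maj := hCov (kk := k + m) (T := C') hC'
  have hN₀ : ∀ y y' : g.Site, 0 ≤ nΩ * (B₀ * Real.exp (-(δC * g.dist y y'))) := fun _ _ =>
    mul_nonneg (Nat.cast_nonneg _) (mul_nonneg hB₀.le (Real.exp_nonneg _))
  have hm₀ : WRow g ρ (fun y y' => nΩ * (B₀ * Real.exp (-(δC * g.dist y y')))) (nΩ * B₀ * cr) := by
    have h := wrow_of_exp (ρ := ρ) (θ := nΩ * B₀) (δ := δC) hdist hrow (mul_nonneg (Nat.cast_nonneg _) hB₀.le) hρ₂
    exact h.mono fun y y' => le_of_eq (by ring)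
  -- STEP 1: `𝔇(C′K′, CK) ≤ (m₀ ε_D + nΩ R_C c_r a_D)·e^{−ρd}`
  have step1 := idef_comp_majorant (b₁ := BlockNorm.ofBlocks g blkη) (b₂ := BlockNorm.ofBlocks g blkΩ)
    (b₂' := BlockNorm.ofBlocks g blkΩ) (b₃' := BlockNorm.ofBlocks g blkΩ)
    (τ₁ := pull prV) (τ₂ := LinearMap.id) (τ₃ := LinearMap.id) (T₁' := C') (T₂' := K') (T₁ := C) (T₂ := K)
    (w := fun _ => (1 : ℝ)) (σ := 0) (C := 1)
    htri hρ (fun _ => zero_le_one) (slowWeight_const 1) zero_le_one (mul_nonneg hnηw hRD0)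
    (mul_nonneg hnηw hcD) hN₀ hm₀ (fun y y' => mul_nonneg (mul_nonneg (Nat.cast_nonneg _) hRC0) (Real.exp_nonneg _))
    hNC_wrow hC'maj hDK hDC hKmaj
  -- (v) the undifferenced FINE left factor `D′_μ`: `nΩ c_D e^{−δ d}`, `‖·‖_ρ ≤ nΩ c_D c_r`
  have hD'maj : HasMaj (BlockNorm.ofBlocks g blkΩ) (BlockNorm.ofBlocks g (blkη ∘ prV)) Dμ'
      (fun y y' => nΩ * (cD * Real.exp (-(δ * g.dist y y')))) :=
    hasMaj_ofBlocks_of_entry_le blkΩ (blkη ∘ prV) (T := Dμ') (κ := fun y y' => cD * Real.exp (-(δ * g.dist y y')))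
      (fun _ _ => mul_nonneg hcD (Real.exp_nonneg _)) hnΩ fun i' b => by
        rw [Function.comp_apply, hsymm]
        exact hdecD' b i'
  have hD'wrow : WRow g ρ (fun y y' => nΩ * (cD * Real.exp (-(δ * g.dist y y')))) (nΩ * cD * cr) := by
    have h := wrow_of_exp (ρ := ρ) (θ := nΩ * cD) (δ := δ) hdist hrow (mul_nonneg (Nat.cast_nonneg _) hcD) hρ₁
    exact h.mono fun y y' => le_of_eq (by ring)
  -- (vi) the DEFECT of the left factor `D_μ` (part 11): `nΩ R_D e^{−δ d}·1`, `‖·‖_ρ ≤ nΩ R_D c_r`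
  have hDD : HasMaj (BlockNorm.ofBlocks g blkΩ) (BlockNorm.ofBlocks g (blkη ∘ prV)) (idef LinearMap.id (pull prV) Dμ' Dμ)
      (fun y y' => nΩ * (RD * Real.exp (-(δ * g.dist y y'))) * (fun _ : g.Site => (1 : ℝ)) y') := by
    have key := hasMaj_idef_dhk163 (L ^ m) (L ^ k) M hα0 hα1 hγ0 hγ1 μ blkΩ (blkη ∘ prV) hnΩ pr hpr prV hprV Dμ hDμ Dμ' hDμ'
      (δ := δ) fun i' b => by
        have h1 := hdomH2 b (prV i')
        simp only [hprV] at h1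
        rw [tdistT_symm, ← blockOf_over M (pr i'.1) i'.1 (hpr i'.1)] at h1
        rw [Function.comp_apply, hsymm]
        simp only [hprV]
        exact h1
    exact key.mono fun y y' => le_of_eq (by rw [hRDdef]; ring)
  have hDD_wrow : WRow g ρ (fun y y' => nΩ * (RD * Real.exp (-(δ * g.dist y y')))) (nΩ * RD * cr) := by
    have h := wrow_of_exp (ρ := ρ) (θ := nΩ * RD) (δ := δ) hdist hrow (mul_nonneg (Nat.cast_nonneg _) hRD0) hρ₁
    exact h.mono fun y y' => le_of_eq (by ring)
  -- (vii) the undifferenced COARSE product `C∘K`: `1·m₀·a_D·e^{−ρd}`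
  have hCK : HasMaj (BlockNorm.ofBlocks g blkη) (BlockNorm.ofBlocks g blkΩ) (C ∘ₗ K)
      (fun y y' => (BlockNorm.ofBlocks g blkΩ).κ * (nΩ * B₀ * cr) * (nη * w * cD) * Real.exp (-((ρ + 0) * g.dist y y'))) := by
    have h := hasMaj_comp_wrow htri hρ (mul_nonneg hnηw hcD) hN₀ hm₀ hCmaj hKmaj'
    simpa only [add_zero] using h
  have hκ : (BlockNorm.ofBlocks g blkΩ).κ = 1 := rfl
  have hcr0 : 0 ≤ cr := le_trans (Finset.sum_nonneg fun _ _ => (Real.exp_pos _).le) (hrow (blkΩ (0, 0)))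
  have hεCK : 0 ≤ (BlockNorm.ofBlocks g blkΩ).κ * (nΩ * B₀ * cr) * (nη * w * RD)
      + (BlockNorm.ofBlocks g blkΩ).κ * (nΩ * RC * cr) * (nη * w * cD) * 1 := by
    rw [hκ]
    have := mul_nonneg hnηw hRD0
    have := mul_nonneg hnηw hcD
    have := hB₀.le
    positivity
  have haCK : 0 ≤ (BlockNorm.ofBlocks g blkΩ).κ * (nΩ * B₀ * cr) * (nη * w * cD) := by
    rw [hκ]
    have := mul_nonneg hnηw hcD
    have := hB₀.le
    positivity
  -- STEP 2: `𝔇(D′_μ(C′K′), D_μ(CK))`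
  have step2 := idef_comp_majorant (b₁ := BlockNorm.ofBlocks g blkη) (b₂ := BlockNorm.ofBlocks g blkΩ)
    (b₂' := BlockNorm.ofBlocks g blkΩ) (b₃' := BlockNorm.ofBlocks g (blkη ∘ prV))
    (τ₁ := pull prV) (τ₂ := LinearMap.id) (τ₃ := pull prV) (T₁' := Dμ') (T₂' := C' ∘ₗ K') (T₁ := Dμ) (T₂ := C ∘ₗ K)
    (w := fun _ => (1 : ℝ)) (σ := 0) (C := 1)
    htri hρ (fun _ => zero_le_one) (slowWeight_const 1) zero_le_one hεCK haCK
    (fun y y' => mul_nonneg (Nat.cast_nonneg _) (mul_nonneg hcD (Real.exp_nonneg _))) hD'wrow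
    (fun y y' => mul_nonneg (Nat.cast_nonneg _) (mul_nonneg hRD0 (Real.exp_nonneg _))) hDD_wrow
    hD'maj step1 hDD hCK
  refine step2.mono fun y y' => le_of_eq ?_
  simp only [hκ]
  ring

end Piece

/-! ## §2 The mixed piece on the concrete unit-torus carrier -/

section Concrete

/-- **THE MIXED SECOND-ORDER PIECE OF THE VECTOR SINGLE-SCALE PIECE ON THE CONCRETE CARRIER** (§1 on `unitTorusGeo L k M`, every geometric binder
discharged: unit bonds ↦ base point (`nΩ = d + 1`), fine bonds ↦ King's block (`n_η = (d+1)(L^k)^{d+1}`), H-dominance with EQUALITY at `δ = δ_H∕2`,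
C-dominance with EQUALITY at `δ_C = δ′` through the canonical indexing, (2.61) at `σ_r = min(δ_H∕2, δ′)∕2` with the volume-independent
`c_r = K_{d+1}(σ_r)`): `𝔇((∂′_μH′)C′(w′(∂′_νH′)ᵀ), (∂_μH)C(w(∂_νH)ᵀ))` has the displayed explicit block majorant times `e^{−ρ|y − y′|_T}` for every
`0 ≤ ρ ≤ min(δ_H∕2, δ′)∕2`. [cite: King1986, (4.42)–(4.43) p.675, Prop. 3.8 (3.71) p.664 (second line); Balaban1984PropagatorsI, (1.63) p.28; Balaban1984PropagatorsII, (2.156) p.250, Lemma 2.1 (2.61) p.234; Balaban1985BackgroundPropagators, (3.44) p.397 (shape)] -/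
theorem hasMaj_idef_vectorPieceMixed_unitTorus (hd : 1 ≤ d) {L : ℕ} [NeZero L] (hL : 1 ≤ L) {α γ : ℝ} (hα0 : 0 ≤ α) (hα1 : α < 1)
    (hγ0 : 0 < γ) (hγ1 : γ < 1) (μ ν : Fin (d + 1)) :
    ∃ B₀ C₁ δ' : ℝ, 0 < B₀ ∧ 0 < C₁ ∧ 0 < δ' ∧ ∀ (M : Fin (d + 1) → ℕ) [∀ μ, NeZero (M μ)] (_ : ∀ i, L ∣ M i)
      (k m : ℕ) (_ : 1 ≤ m)
      (pr : Tor (fine (L ^ m * L ^ k) M) → Tor (fine (L ^ k) M)) (_ : ∀ x' μ, (pr x' μ).val = (x' μ).val / L ^ m)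
      (prV : Tor (fine (L ^ m * L ^ k) M) × Fin (d + 1) → Tor (fine (L ^ k) M) × Fin (d + 1))
      (_ : ∀ i, prV i = (pr i.1, i.2))
      (Dμ : (Tor M × Fin (d + 1) → ℝ) →ₗ[ℝ] (Tor (fine (L ^ k) M) × Fin (d + 1) → ℝ))
      (_ : ∀ b i, Dμ (Pi.single b 1) i = ((B5Prop11Plancherel.fdiff (fine (L ^ k) M) ((L ^ k : ℕ) : ℂ) μ * HkOp (L ^ k) M) i b).re)
      (Dμ' : (Tor M × Fin (d + 1) → ℝ) →ₗ[ℝ] (Tor (fine (L ^ m * L ^ k) M) × Fin (d + 1) → ℝ))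
      (_ : ∀ b i, Dμ' (Pi.single b 1) i =
        ((B5Prop11Plancherel.fdiff (fine (L ^ m * L ^ k) M) ((L ^ m * L ^ k : ℕ) : ℂ) μ * HkOp (L ^ m * L ^ k) M) i b).re)
      (Dν : (Tor M × Fin (d + 1) → ℝ) →ₗ[ℝ] (Tor (fine (L ^ k) M) × Fin (d + 1) → ℝ))
      (_ : ∀ b i, Dν (Pi.single b 1) i = ((B5Prop11Plancherel.fdiff (fine (L ^ k) M) ((L ^ k : ℕ) : ℂ) ν * HkOp (L ^ k) M) i b).re)
      (Dν' : (Tor M × Fin (d + 1) → ℝ) →ₗ[ℝ] (Tor (fine (L ^ m * L ^ k) M) × Fin (d + 1) → ℝ))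
      (_ : ∀ b i, Dν' (Pi.single b 1) i =
        ((B5Prop11Plancherel.fdiff (fine (L ^ m * L ^ k) M) ((L ^ m * L ^ k : ℕ) : ℂ) ν * HkOp (L ^ m * L ^ k) M) i b).re)
      {w : ℝ} (_ : 0 ≤ w) (K : (Tor (fine (L ^ k) M) × Fin (d + 1) → ℝ) →ₗ[ℝ] (Tor M × Fin (d + 1) → ℝ))
      (_ : ∀ i b, K (Pi.single i 1) b = w * Dν (Pi.single b 1) i)
      (K' : (Tor (fine (L ^ m * L ^ k) M) × Fin (d + 1) → ℝ) →ₗ[ℝ] (Tor M × Fin (d + 1) → ℝ))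
      (_ : ∀ i' b, K' (Pi.single i' 1) b = w / ((L : ℝ) ^ m) ^ (d + 1) * Dν' (Pi.single b 1) i')
      (C : (Tor M × Fin (d + 1) → ℝ) →ₗ[ℝ] (Tor M × Fin (d + 1) → ℝ))
      (_ : ∀ b b', C (Pi.single b' 1) b =
        (bondReductionT L M (deltaPol M (L ^ k))).cov (⟨rep M b.1, rep_mem_pbox M b.1⟩, b.2) (⟨rep M b'.1, rep_mem_pbox M b'.1⟩, b'.2))
      (C' : (Tor M × Fin (d + 1) → ℝ) →ₗ[ℝ] (Tor M × Fin (d + 1) → ℝ))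
      (_ : ∀ b b', C' (Pi.single b' 1) b =
        (bondReductionT L M (deltaPol M (L ^ (k + m)))).cov (⟨rep M b.1, rep_mem_pbox M b.1⟩, b.2) (⟨rep M b'.1, rep_mem_pbox M b'.1⟩, b'.2))
      {ρ : ℝ} (_ : 0 ≤ ρ) (_ : ρ ≤ min (kappa163 (d + 1) / (d + 1) / 2) δ' / 2),
      HasMaj (BlockNorm.ofBlocks (unitTorusGeo L k M) (fun i : Tor (fine (L ^ k) M) × Fin (d + 1) => blockOf (L ^ k) M i.1))
        (BlockNorm.ofBlocks (unitTorusGeo L k M)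
          ((fun i : Tor (fine (L ^ k) M) × Fin (d + 1) => blockOf (L ^ k) M i.1) ∘ prV))
        (idef (pull prV) (pull prV) (Dμ' ∘ₗ (C' ∘ₗ K')) (Dμ ∘ₗ (C ∘ₗ K)))
        (fun y y' =>
          (((d + 1 : ℕ) : ℝ) * (MD163 (d + 1) * periodConst (kappa163 (d + 1)) d) * B4Sect5Proof.latticeConst (d + 1) (min (kappa163 (d + 1) / (d + 1) / 2) δ' / 2) *
              (((d + 1 : ℕ) : ℝ) * B₀ * B4Sect5Proof.latticeConst (d + 1) (min (kappa163 (d + 1) / (d + 1) / 2) δ' / 2) *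
                  ((((d + 1) * (L ^ k) ^ (d + 1) : ℕ) : ℝ) * w * ((2 ^ (1 - α) * (((d + 1 : ℕ) : ℝ) / ((L ^ k : ℕ) : ℝ)) ^ α *
                  (C0maj (d + 1) * (Real.pi * Real.pi ^ α) + C1maj (d + 1) * aliasConst (d + 1) α)
                + T163 (d + 1) 0 γ / ((L ^ k : ℕ) : ℝ) ^ γ) ^ (1 / 2 : ℝ)
              * (2 * (MD163 (d + 1) * periodConst (kappa163 (d + 1)) d)) ^ (1 / 2 : ℝ)))
                + ((d + 1 : ℕ) : ℝ) * (C₁ * ((L : ℝ) ^ k)⁻¹) * B4Sect5Proof.latticeConst (d + 1) (min (kappa163 (d + 1) / (d + 1) / 2) δ' / 2) *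
                  ((((d + 1) * (L ^ k) ^ (d + 1) : ℕ) : ℝ) * w * (MD163 (d + 1) * periodConst (kappa163 (d + 1)) d)))
            + ((d + 1 : ℕ) : ℝ) * ((2 ^ (1 - α) * (((d + 1 : ℕ) : ℝ) / ((L ^ k : ℕ) : ℝ)) ^ α *
                  (C0maj (d + 1) * (Real.pi * Real.pi ^ α) + C1maj (d + 1) * aliasConst (d + 1) α)
                + T163 (d + 1) 0 γ / ((L ^ k : ℕ) : ℝ) ^ γ) ^ (1 / 2 : ℝ)
              * (2 * (MD163 (d + 1) * periodConst (kappa163 (d + 1)) d)) ^ (1 / 2 : ℝ)) * B4Sect5Proof.latticeConst (d + 1) (min (kappa163 (d + 1) / (d + 1) / 2) δ' / 2) *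
              (((d + 1 : ℕ) : ℝ) * B₀ * B4Sect5Proof.latticeConst (d + 1) (min (kappa163 (d + 1) / (d + 1) / 2) δ' / 2) * ((((d + 1) * (L ^ k) ^ (d + 1) : ℕ) : ℝ) * w * (MD163 (d + 1) * periodConst (kappa163 (d + 1)) d)))) *
          Real.exp (-(ρ * tdistT M y y'))) := by
  obtain ⟨B₀, C₁, δ', hB₀, hC₁, hδ', HP⟩ := hasMaj_idef_vectorPieceMixed (d := d) hd hL hα0 hα1 hγ0 hγ1 μ ν
  refine ⟨B₀, C₁, δ', hB₀, hC₁, hδ', ?_⟩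
  intro M _ hLM k m hm pr hpr prV hprV Dμ hDμ Dμ' hDμ' Dν hDν Dν' hDν' w hw0 K hK K' hK' C hC C' hC' ρ hρ hρ'
  have hσ : 0 < min (kappa163 (d + 1) / (d + 1) / 2) δ' / 2 :=
    half_pos (lt_min (half_pos (div_pos (kappa163_pos _) (by positivity))) hδ')
  have hmin₁ : min (kappa163 (d + 1) / (d + 1) / 2) δ' ≤ kappa163 (d + 1) / (d + 1) / 2 := min_le_left _ _
  have hmin₂ : min (kappa163 (d + 1) / (d + 1) / 2) δ' ≤ δ' := min_le_right _ _
  exact HP M hLM k m hm (g := unitTorusGeo L k M) (triangle254_unitTorusGeo L k M) (unitTorusGeo_dist_nonneg L k M)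
    (unitTorusGeo_dist_symm L k M) hσ.le (rowSum_unitTorusGeo L k M hσ)
    (fun b : Tor M × Fin (d + 1) => b.1) (fun y' => (card_fibre_unitBond M y').le)
    (fun i : Tor (fine (L ^ k) M) × Fin (d + 1) => blockOf (L ^ k) M i.1) (fun y' => (card_fibre_fineBond (L ^ k) M y').le)
    pr hpr prV hprV Dμ hDμ Dμ' hDμ' Dν hDν Dν' hDν' hw0 K hK K' hK'
    (fun b : Tor M × Fin (d + 1) => ((⟨rep M b.1, rep_mem_pbox M b.1⟩, b.2) : B4.Idx (pbox M) (d + 1))) C hC C' hC'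
    (δ := kappa163 (d + 1) / (d + 1) / 2) (fun b i => le_rfl)
    (δC := δ') (fun b b' => by rw [pdist_rep_rep])
    hρ (by linarith) (by linarith)

end Concrete

end Summit.QuantumFields.YangMills.BalabanUVNodes.N15.DefectKernel
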